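import Mathlib
import Literature.Analysis.FluidPDE.WholeSpaceIBP
import Summits.NavierStokesRegularity.NavierStokesRegularity.Theorems.EulerZoomLiouvillePowerGaugeEulerLiouvilleExtinctIdentityTools
import Summits.NavierStokesRegularity.NavierStokesRegularity.Theorems.EulerZoomLiouvillePowerGaugeEulerLiouvilleWindowIdentity
import Summits.NavierStokesRegularity.NavierStokesRegularity.Theorems.EulerZoomLiouvillePowerGaugeEulerLiouvilleAllRhoStrata
import HarnessLib

/-!
# NO CONSERVATIVE EULER COLLAPSE INTO REST: the extinct-trace stratum X2 of the crux
# `EulerZoomLiouville.PowerGaugeEulerLiouville` (stmt-NavierStokesRegularity-19832; line `extinct-trace` of ns-idea-11 g5,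
# stub X2 `stub_extinctIdentity` BY NAME; width seat ns-ezl-w1 g4)

Route №10 `EulerZoomLiouville` (NavierStokesRegularity).  Seregin arXiv:2507.08733 §2: a first-singularity Euler zoom limit is
CONSERVATIVE (local energy identity) and, off critical energy concentration, ENERGY-EXTINCT at the final time; then the identity
between a time `s < 0` and the final time kills it once the flux through the final window is `o(a)`.  Inside Seregin's power-gauged
class the final-window flux is `O(a^{3/2 − 9ρ/4})` from the gauges alone (the lead's `exists_oneBall_window_le_split`, typed in the
line file as `HasFinalWindowFluxBound`), which beats the cutoff gradient `1/a` exactly for `ρ > 2/9`.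

* **`extinctIdentity`** = `Sig.stub_extinctIdentity` of `Cruxes/PowerGaugeEulerLiouville/Lines/extinct_trace.lean` (BODIES VERBATIM): for
  `2/9 < ρ ≤ 1/2`, a member of the class with the final-window flux bound which is CONSERVATIVE and ENERGY-EXTINCT is trivial.

Proof (the card's plan, with the window identity now a tree theorem): cutoffs `χ_n = cutoff 2ⁿ` (`= 1` on `B_{2ⁿ}`, supported in
`B̄_{2^{n+1}}`, `‖∇χ_n‖ ≤ C₀/2ⁿ`); ezl-w6's `WindowIdentity.hasWindowIdentity_of_isEnergyConservative` gives null sets `N_n` off which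
`E_n(σ) − E_n(s) = ∫_{(s,σ)}∫ (|u|² + 2p)⟪u, ∇χ_n⟫`; the flux is `≤ (C₀/2ⁿ) M (3·2ⁿ)^{3/2−9ρ/4}` UNIFORMLY in `σ`
(`ExtinctTrace.abs_integral_integral_flux_le`); extinction supplies good `σ` arbitrarily close to `0⁻` with `E_n(σ) ≤ ε`; hence
`∫_{B_{2ⁿ}}|u(s)|² ≤ E_n(s) ≤ C₀ M 3^{3/2−9ρ/4} (2ⁿ)^{1/2−9ρ/4} → 0`, so `∫|u(s)|² = 0` for a.e. `s < 0`, and the lead's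
energy-vanishing stratum `ae_eq_zero_of_gauge_of_energyVanishing_allRho` closes.

HONEST LABEL: a weak-class STRATUM (time-mirror of «no Euler collapse from rest»); every self-similar / DSS candidate is energy-PERSISTENT
and untouched.  WHAT THIS IS NOT: not NS, not E — `--supports` stmt-19832; 19832 OPEN; NS regularity NOT proved.
[cite: Seregin2025TypeIIScenario, §2 pp. 4–6; CaffarelliKohnNirenberg1982 §2]
-/

noncomputable section

-- flat `Theorems/<Route><Decl>…` files of one crux share the namespace of the crux (tree convention)
set_option linter.dupNamespace false

open MeasureTheory Set Filter Topology Metric Function InnerProductSpace TopologicalSpace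
open scoped RealInnerProductSpace NNReal ENNReal

namespace Summit.NavierStokesRegularity.NavierStokesRegularity.Theorems.PowerGaugeEulerLiouville.ExtinctTrace

open Literature.Analysis Literature.Analysis.FluidPDE

/-- The cutoff `cutoff R` is supported in the closed ball `B̄_{2R}`. [folklore] -/
theorem tsupport_cutoff_subset {R : ℝ} (hR : 0 < R) :
    tsupport (cutoff (E := EuclideanSpace ℝ (Fin 3)) R) ⊆ closedBall (0 : EuclideanSpace ℝ (Fin 3)) (2 * R) := by
  refine closure_minimal (fun x hx => ?_) isClosed_closedBall
  rw [mem_closedBall_zero_iff]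
  by_contra h
  exact hx (cutoff_eq_zero hR (not_le.1 h).le)

/-- The gradient of the cutoff has the norm of its Fréchet derivative. [folklore] -/
theorem norm_gradient_eq_norm_fderiv (χ : EuclideanSpace ℝ (Fin 3) → ℝ) (x : EuclideanSpace ℝ (Fin 3)) :
    ‖gradient χ x‖ = ‖fderiv ℝ χ x‖ := by
  rw [gradient, LinearIsometryEquiv.norm_map]

/-- **NO CONSERVATIVE EULER COLLAPSE INTO REST** (`Sig.stub_extinctIdentity` of `Lines/extinct_trace.lean`, bodies verbatim:
`InClass ρ u p H c → HasFinalWindowFluxBound ρ u p → IsExtinctConservative u p → VanishesAE u`, `2/9 < ρ ≤ 1/2`).  A member of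
Seregin's power-gauged ancient Euler class with the final-window flux bound `∫∫_{(s,0)×B_a}(|u|³ + 2|p||u|) ≤ M a^{3/2−9ρ/4}`, which
satisfies the local energy EQUALITY and whose energy on every fixed ball tends to `0` as `τ → 0⁻`, vanishes a.e. on the slab.
[cite: Seregin2025TypeIIScenario, §2] -/
theorem extinctIdentity :
    ∀ ρ : ℝ, 2 / 9 < ρ → ρ ≤ 1 / 2 →
      ∀ (u : ℝ → EuclideanSpace ℝ (Fin 3) → EuclideanSpace ℝ (Fin 3)) (p : ℝ → EuclideanSpace ℝ (Fin 3) → ℝ)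
        (H : ℝ → EuclideanSpace ℝ (Fin 3) → EuclideanSpace ℝ (Fin 3) →L[ℝ] EuclideanSpace ℝ (Fin 3)) (c : ℝ≥0),
      (IsSuitableWeakSolutionOn (slab (EuclideanSpace ℝ (Fin 3)) (Set.Iio 0) isOpen_Iio) 0 0 u p ∧
        HasWeakSpatialGradientOn (slab (EuclideanSpace ℝ (Fin 3)) (Set.Iio 0) isOpen_Iio) u H ∧
        (∀ a : ℝ, 0 < a →
          ENNReal.ofReal (a ^ (2 * ρ)) * cknA a (0 : ℝ × EuclideanSpace ℝ (Fin 3)) u +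
              ENNReal.ofReal (a ^ ρ) * cknE a (0 : ℝ × EuclideanSpace ℝ (Fin 3)) H +
            ENNReal.ofReal (a ^ (2 * ρ)) * cknD a (0 : ℝ × EuclideanSpace ℝ (Fin 3)) p ≤ (c : ℝ≥0∞))) →
      (∀ s : ℝ, s < 0 → ∃ M : ℝ, 0 ≤ M ∧ ∀ a : ℝ, 1 ≤ a → -(a ^ 2) ≤ s →
        ∫⁻ z in Set.Ioo s 0 ×ˢ Metric.ball (0 : EuclideanSpace ℝ (Fin 3)) a,
            (‖u z.1 z.2‖ₑ ^ (3 : ℕ) + 2 * (‖p z.1 z.2‖ₑ * ‖u z.1 z.2‖ₑ)) ≤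
          ENNReal.ofReal (M * a ^ (3 / 2 - 9 * ρ / 4))) →
      ((∀ φ : ℝ → EuclideanSpace ℝ (Fin 3) → ℝ,
          IsSpaceTimeTestOn (slab (EuclideanSpace ℝ (Fin 3)) (Set.Iio 0) isOpen_Iio) φ →
          ∫ t, ∫ x, (‖u t x‖ ^ 2 * timeDeriv φ t x + (‖u t x‖ ^ 2 + 2 * p t x) * ⟪u t x, gradient (φ t) x⟫) = 0) ∧
        (∀ a : ℝ, 0 < a →
          Tendsto (fun τ : ℝ => ∫⁻ x in Metric.ball (0 : EuclideanSpace ℝ (Fin 3)) a, ‖u τ x‖ₑ ^ 2)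
            (𝓝[<] (0 : ℝ)) (𝓝 0))) →
      Function.uncurry u =ᵐ[volume.restrict (Set.Iio (0 : ℝ) ×ˢ (Set.univ : Set (EuclideanSpace ℝ (Fin 3))))] 0 := by
  intro ρ hρ1 hρ2 u p H c hcls hflux hEC
  obtain ⟨hcons, hext⟩ := hEC
  obtain ⟨hsw, hH, hgauge⟩ := hcls
  have hρ0 : 0 ≤ ρ := by linarith
  have hA : ∀ a : ℝ, 0 < a →
      ENNReal.ofReal (a ^ (2 * ρ)) * cknA a (0 : ℝ × EuclideanSpace ℝ (Fin 3)) u ≤ (c : ℝ≥0∞) :=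
    fun a ha => le_trans (le_trans le_self_add le_self_add) (hgauge a ha)
  -- ### cutoffs `χ_n = cutoff (2^n)` and their gradient bound
  obtain ⟨C₀, hC₀, hDχ⟩ := exists_norm_fderiv_cutoff_le (E := EuclideanSpace ℝ (Fin 3))
  set a : ℕ → ℝ := fun n => (2 : ℝ) ^ n with ha_def
  have ha : ∀ n, 0 < a n := fun n => by positivity
  have ha1 : ∀ n, 1 ≤ a n := fun n => one_le_pow₀ one_le_two
  have hamono : ∀ {m n : ℕ}, m ≤ n → a m ≤ a n := fun h => pow_le_pow_right₀ one_le_two h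
  have hka : ∀ k : ℕ, (k : ℝ) ≤ a k := fun k => by
    show (k : ℝ) ≤ (2 : ℝ) ^ k
    exact_mod_cast (Nat.lt_two_pow_self (n := k)).le
  -- ### the window identity for each cutoff (ezl-w6's O2), off a null set `N n`
  have hwin := WindowIdentity.hasWindowIdentity_of_isEnergyConservative ⟨hsw, hH, hgauge⟩ hcons
  choose N hN0 hNid using fun n : ℕ =>
    hwin (cutoff (a n)) (contDiff_cutoff (a n)) (hasCompactSupport_cutoff (ha n))
  have hUnull : volume (⋃ n, N n) = 0 := measure_iUnion_null hN0
  -- ### measurability of the member and of a.e. slice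
  have hum : AEStronglyMeasurable (uncurry u)
      (volume.restrict (Iio (0 : ℝ) ×ˢ (univ : Set (EuclideanSpace ℝ (Fin 3))))) := by
    simpa [slab] using hH.locallyIntegrableOn.aestronglyMeasurable
  have hpm : AEStronglyMeasurable (uncurry p)
      (volume.restrict (Iio (0 : ℝ) ×ˢ (univ : Set (EuclideanSpace ℝ (Fin 3))))) := by
    simpa [slab] using hsw.distributional.2.2.1.aestronglyMeasurable
  have hmeas := ae_aestronglyMeasurable_slice hum
  -- ### core: a good time `s < 0` carries no energy
  have hcore : ∀ s : ℝ, s < 0 → (∀ n, s ∉ N n) → AEStronglyMeasurable (u s) volume →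
      ∫⁻ x, ‖u s x‖ₑ ^ 2 = 0 := by
    intro s hs hsN hsm
    obtain ⟨M, hM0, hM⟩ := hflux s hs
    -- a first index with `-s ≤ a n₀`
    obtain ⟨n₀, hn₀⟩ : ∃ n₀ : ℕ, -s ≤ a n₀ := by
      obtain ⟨k, hk⟩ := exists_nat_gt (-s)
      exact ⟨k, hk.le.trans (hka k)⟩
    set e : ℝ := 3 / 2 - 9 * ρ / 4 with he_def
    -- the bound at level `n ≥ n₀`
    have hstep : ∀ n, n₀ ≤ n →
        ∫⁻ x in ball (0 : EuclideanSpace ℝ (Fin 3)) (a n), ‖u s x‖ₑ ^ 2 ≤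
          ENNReal.ofReal (C₀ / a n * (M * (3 * a n) ^ e)) := by
      intro n hn
      have han : -s ≤ a n := hn₀.trans (hamono hn)
      have hs9 : s ∈ Ioo (-((3 * a n) ^ 2)) 0 := by
        refine ⟨?_, hs⟩
        nlinarith [ha n, ha1 n]
      -- (i) the slice at `s` is square-integrable on `B_{3 aₙ}`; `χ_n |u(s)|²` is integrable
      have hfin : ∫⁻ x in ball (0 : EuclideanSpace ℝ (Fin 3)) (3 * a n), ‖u s x‖ₑ ^ 2 < ⊤ :=
        setLIntegral_ball_enorm_sq_lt_top_of_gaugeA hA (by positivity) hs9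
      have hχsupp : ∀ x, x ∉ ball (0 : EuclideanSpace ℝ (Fin 3)) (3 * a n) → cutoff (a n) x = 0 := by
        intro x hx
        rw [mem_ball_zero_iff, not_lt] at hx
        exact cutoff_eq_zero (ha n) (by linarith [ha n])
      have hχgrad0 : ∀ x, x ∉ ball (0 : EuclideanSpace ℝ (Fin 3)) (3 * a n) → gradient (cutoff (a n)) x = 0 := by
        intro x hx
        refine gradient_eq_zero_of_notMem_tsupport fun h => hx ?_
        have h2 := tsupport_cutoff_subset (ha n) h
        rw [mem_closedBall_zero_iff] at h2
        rw [mem_ball_zero_iff]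
        linarith [ha n]
      have hint : Integrable (fun x => cutoff (a n) x * ‖u s x‖ ^ 2) volume := by
        have hm : AEStronglyMeasurable (fun x => cutoff (a n) x * ‖u s x‖ ^ 2) volume :=
          ((contDiff_cutoff (n := 0) (a n)).continuous.aestronglyMeasurable).mul (hsm.norm.pow 2)
        refine ⟨hm, ?_⟩
        have hdom : ∀ x, ‖cutoff (a n) x * ‖u s x‖ ^ 2‖ₑ ≤
            (ball (0 : EuclideanSpace ℝ (Fin 3)) (3 * a n)).indicator (fun x => ‖u s x‖ₑ ^ 2) x := by
          intro x
          by_cases hx : x ∈ ball (0 : EuclideanSpace ℝ (Fin 3)) (3 * a n)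
          · rw [indicator_of_mem hx, Real.enorm_eq_ofReal (mul_nonneg (cutoff_nonneg _ _) (sq_nonneg _)),
              ← ofReal_norm, ← ENNReal.ofReal_pow (norm_nonneg _)]
            exact ENNReal.ofReal_le_ofReal
              (by nlinarith [cutoff_le_one (a n) x, cutoff_nonneg (a n) x, sq_nonneg ‖u s x‖])
          · rw [indicator_of_notMem hx, hχsupp x hx, zero_mul, enorm_zero]
        calc ∫⁻ x, ‖cutoff (a n) x * ‖u s x‖ ^ 2‖ₑ
            ≤ ∫⁻ x, (ball (0 : EuclideanSpace ℝ (Fin 3)) (3 * a n)).indicator (fun x => ‖u s x‖ₑ ^ 2) x :=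
              lintegral_mono hdom
          _ = ∫⁻ x in ball (0 : EuclideanSpace ℝ (Fin 3)) (3 * a n), ‖u s x‖ₑ ^ 2 :=
              lintegral_indicator measurableSet_ball _
          _ < ⊤ := hfin
      -- (ii) the flux bound, uniformly in `σ ≤ 0`
      have hsub : Ioo s 0 ×ˢ ball (0 : EuclideanSpace ℝ (Fin 3)) (3 * a n) ⊆
          Iio (0 : ℝ) ×ˢ (univ : Set (EuclideanSpace ℝ (Fin 3))) :=
        prod_mono (fun t ht => ht.2) (subset_univ _)
      have hum' := hum.mono_measure (Measure.restrict_mono hsub le_rfl)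
      have hpm' := hpm.mono_measure (Measure.restrict_mono hsub le_rfl)
      have hMn : 0 ≤ M * (3 * a n) ^ e := mul_nonneg hM0 (Real.rpow_nonneg (by positivity) _)
      have hfl := hM (3 * a n) (by linarith [ha1 n]) hs9.1.le
      have hD : ∀ x, ‖gradient (cutoff (a n)) x‖ ≤ C₀ / a n := fun x => by
        rw [norm_gradient_eq_norm_fderiv]; exact hDχ (a n) (ha n) x
      have hF : ∀ σ : ℝ, σ ≤ 0 →
          |∫ τ in Ioo s σ, ∫ x, (‖u τ x‖ ^ 2 + 2 * p τ x) * ⟪u τ x, gradient (cutoff (a n)) x⟫| ≤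
            C₀ / a n * (M * (3 * a n) ^ e) := fun σ hσ =>
        abs_integral_integral_flux_le hum' hpm' (div_nonneg hC₀ (ha n).le) hD hχgrad0 hMn hfl hσ
      -- (iii) extinction + window identity: `E_n(s) ≤ flux bound`
      have hEs : ∫ x, cutoff (a n) x * ‖u s x‖ ^ 2 ≤ C₀ / a n * (M * (3 * a n) ^ e) := by
        refine le_of_forall_pos_le_add fun ε hε => ?_
        have hev : ∀ᶠ τ in 𝓝[<] (0 : ℝ),
            ∫⁻ x in ball (0 : EuclideanSpace ℝ (Fin 3)) (3 * a n), ‖u τ x‖ₑ ^ 2 < ENNReal.ofReal ε :=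
          (hext (3 * a n) (by positivity)).eventually (gt_mem_nhds (ENNReal.ofReal_pos.2 hε))
        obtain ⟨l, hl0, hl⟩ := mem_nhdsLT_iff_exists_Ioo_subset.1 hev
        set I : Set ℝ := Ioo (max s l) 0 with hI
        have hIpos : volume I ≠ 0 := by
          rw [hI, Real.volume_Ioo]
          have : 0 < 0 - max s l := by linarith [max_lt hs hl0]
          simpa using this
        obtain ⟨σ, hσI, hσN⟩ : (I \ ⋃ n, N n).Nonempty :=
          nonempty_of_measure_ne_zero (by rw [measure_sdiff_null hUnull]; exact hIpos)
        have hσs : s < σ := lt_of_le_of_lt (le_max_left _ _) hσI.1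
        have hσl : l < σ := lt_of_le_of_lt (le_max_right _ _) hσI.1
        have hσ0 : σ < 0 := hσI.2
        have hσNn : σ ∉ N n := fun h => hσN (mem_iUnion.2 ⟨n, h⟩)
        have hid := hNid n s σ hσs hσ0 (hsN n) hσNn
        have hEσ : ∫ x, cutoff (a n) x * ‖u σ x‖ ^ 2 ≤ ε :=
          integral_mul_sq_le_of_setLIntegral_le (cutoff_nonneg (a n)) (cutoff_le_one (a n)) hχsupp hε.le
            (hl ⟨hσl, hσ0⟩).le
        have hFσ := abs_le.1 (hF σ hσ0.le)
        linarith [hFσ.1, hFσ.2]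
      -- (iv) the ball energy at `s`
      exact (setLIntegral_ball_le_ofReal_integral (cutoff_nonneg (a n))
        (fun x hx => cutoff_eq_one (ha n) (le_of_lt (mem_ball_zero_iff.1 hx))) hint).trans
        (ENNReal.ofReal_le_ofReal hEs)
    -- (v) the bound tends to zero (`ρ > 2/9`)
    have hlim : Tendsto (fun n : ℕ => ENNReal.ofReal (C₀ / a n * (M * (3 * a n) ^ e))) atTop (𝓝 0) := by
      have hy : 0 < 9 * ρ / 4 - 1 / 2 := by linarith
      have hform : ∀ n, C₀ / a n * (M * (3 * a n) ^ e) =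
          C₀ * M * (3 : ℝ) ^ e * (a n) ^ (-(9 * ρ / 4 - 1 / 2)) := by
        intro n
        have e1 : (3 * a n) ^ e = (3 : ℝ) ^ e * (a n) ^ e := Real.mul_rpow (by norm_num) (ha n).le
        have e2 : (a n) ^ (-(9 * ρ / 4 - 1 / 2)) = (a n) ^ e / a n := by
          rw [show -(9 * ρ / 4 - 1 / 2) = e - 1 by rw [he_def]; ring, Real.rpow_sub_one (ha n).ne']
        rw [e1, e2]
        field_simp
      simp_rw [hform]
      have h1 : Tendsto (fun n : ℕ => (a n) ^ (-(9 * ρ / 4 - 1 / 2))) atTop (𝓝 0) :=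
        (tendsto_rpow_neg_atTop hy).comp (tendsto_pow_atTop_atTop_of_one_lt one_lt_two)
      have h2 := h1.const_mul (C₀ * M * (3 : ℝ) ^ e)
      rw [mul_zero] at h2
      have h3 := ENNReal.tendsto_ofReal h2
      rwa [ENNReal.ofReal_zero] at h3
    -- (vi) every dyadic ball carries no energy at time `s`
    have hball : ∀ m : ℕ, ∫⁻ x in ball (0 : EuclideanSpace ℝ (Fin 3)) (a m), ‖u s x‖ₑ ^ 2 = 0 := by
      intro m
      refine le_antisymm (ge_of_tendsto hlim ?_) bot_le
      refine eventually_atTop.2 ⟨max m n₀, fun n hn => ?_⟩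
      exact (lintegral_mono_set (ball_subset_ball (hamono (le_of_max_le_left hn)))).trans
        (hstep n (le_of_max_le_right hn))
    have hcov : (univ : Set (EuclideanSpace ℝ (Fin 3))) ⊆ ⋃ m : ℕ, ball (0 : EuclideanSpace ℝ (Fin 3)) (a m) := by
      intro x _
      obtain ⟨m, hm⟩ := exists_nat_gt ‖x‖
      exact mem_iUnion.2 ⟨m, mem_ball_zero_iff.2 (hm.trans_le (hka m))⟩
    refine le_antisymm ?_ bot_le
    calc ∫⁻ x, ‖u s x‖ₑ ^ 2 = ∫⁻ x in univ, ‖u s x‖ₑ ^ 2 := by rw [Measure.restrict_univ]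
      _ ≤ ∫⁻ x in ⋃ m : ℕ, ball (0 : EuclideanSpace ℝ (Fin 3)) (a m), ‖u s x‖ₑ ^ 2 := lintegral_mono_set hcov
      _ ≤ ∑' m : ℕ, ∫⁻ x in ball (0 : EuclideanSpace ℝ (Fin 3)) (a m), ‖u s x‖ₑ ^ 2 := lintegral_iUnion_le _ _
      _ = 0 := by simp [hball]
  -- ### conclusion: the energy-vanishing stratum of the lead
  have hgood : ∀ᵐ s ∂(volume : Measure ℝ), (∀ n, s ∉ N n) ∧ (s < 0 → AEStronglyMeasurable (u s) volume) :=
    (ae_all_iff.2 fun n => measure_eq_zero_iff_ae_notMem.1 (hN0 n)).and hmeas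
  refine ae_eq_zero_of_gauge_of_energyVanishing_allRho hρ0 hsw hH hgauge fun ε hε T => ?_
  intro h0
  have hI : ∀ᵐ s ∂(volume : Measure ℝ), s ∉ Ioo (-(|T| + 2)) (-(|T| + 1)) := by
    filter_upwards [hgood, measure_eq_zero_iff_ae_notMem.1 h0] with s hg hnot hsI
    apply hnot
    have hs0 : s < 0 := by linarith [hsI.2, abs_nonneg T]
    refine ⟨by linarith [hsI.2, le_abs_self T], ?_⟩
    rw [hcore s hs0 hg.1 (hg.2 hs0)]
    exact bot_le
  have := measure_eq_zero_iff_ae_notMem.2 hI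
  rw [Real.volume_Ioo] at this
  have h1 : (0 : ℝ) < -(|T| + 1) - -(|T| + 2) := by linarith
  exact absurd this (ENNReal.ofReal_pos.2 h1).ne'

end Summit.NavierStokesRegularity.NavierStokesRegularity.Theorems.PowerGaugeEulerLiouville.ExtinctTrace

end
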